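import Summits.Ventures.QEC.Census.CertCoverChecks
import Summits.Ventures.QEC.Census.BB.BB288Data
import Summits.Ventures.QEC.Census.BB.BB144Rank
import Summits.Ventures.QEC.Census.BB.BB72Rank
import HarnessLib

set_option Elab.async false

/-!
# `[[288,12,18]]` cover certificate — DATA 1b: logical bases of the three codes (dual pairs, `logOK` decided) and the six
`C_M` functionals `Lam2`.  The `Z` bases are the census gens bases; the `X` bases are their duals (`⟨LX_i, LZ_j⟩ = δ_ij`).
-/

namespace Summit.Ventures.QEC.Census.BB288Cover

open Summit.Ventures.QEC.Census

/-- A `Z`-logical basis of `BB.bb288` (12 words on 288 qubits; census gens basis). -/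
def LZ288 : List ℕ :=
  [
    5516815419347639576949469376153124, 11033630838695279153898938752306248, 22067261658052467560165274097289361,
    44134523316104935120330548194574627, 22596875957647931707185026564723195904, 45193751915295863414370053129446391808,
    9776178379399953189958699740210754817597732199907, 17268202931833751429040836558400627645930293026816, 7862788914590820897308217839806402655852531930904898,
    15715989021581738775543738564120103895072955717167426, 24321308365263778240056707375328567786566321513956513, 48642611400486105199401979708018537347626525712019456]

/-- The DUAL `X`-logical basis: `⟨LX288_i, LZ288_j⟩ = δ_ij`. -/
def LX288 : List ℕ :=
  [
    201913400114923251991783099973074727081350291507241, 178145154389497680342365596065567599442935561646397, 29701247503560028682920840784729586456888844546535,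
    356270015068177642100011228649038937595804331180494, 39137824174261644560916415086018562412634290906, 160308460855623784328731417220993263239710275384832,
    320656059513629128540012390372714447739375747520731, 267259043695655030008221056903314767961789467571126, 160373690529892943251998566164362076302278876424045,
    320656059508197903602232543562396504924161116135130, 267259043706545400492682842007938858040618697733558, 160373690529883636380674334768453293307310460856685]

/-- A `Z`-logical basis of `BB.bb144` (gens basis = `BB144.bzData.LZ`). -/
def LZ144 : List ℕ :=
  [
    90075497242034227, 180146665157034023, 306248897834254396,
    612493466341474361, 5764831823490190528, 11529386570050177472,
    2148676749982766223589824, 2762584392478743506977344, 20273119328973762505236800,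
    39049248464586372748460864, 78046550880119572544672704, 155705867691192294687961856]

/-- Its dual `X`-logical basis. -/
def LX144 : List ℕ :=
  [
    12136481860974988199364775, 3116761878693965841082255, 6233523757387931682164510,
    15494084430295305946347708, 8160249282398746929379008, 13600415470664578215631680,
    83010634824399458377, 153734137460586698232, 230000928642320725792,
    73933383415978033736, 82143188800828830640, 164268640348797597473]

/-- A `Z`-logical basis of `BB.bb72` (gens basis). -/
def LZ72 : List ℕ :=
  [
    1310771, 2621479, 4456508,
    8912953, 83889344, 167774656,
    31267396258193, 40200944223744, 295014895352097,
    568242477975329, 1135727866794961, 2265819678244641]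

/-- Its dual `X`-logical basis. -/
def LX72 : List ℕ :=
  [
    226981507741506, 45356147959470, 90713137224423,
    225468722497860, 241206690611591, 197915354758408,
    201624152884927, 121841869285461, 201626291577302,
    121840708173797, 121840827551261, 239352327806074]

/-- The six functionals on 144 qubits annihilating `P₁(ker H^X₂₈₈)` (= `C_M` of README §1). -/
def Lam2 : List ℕ :=
  [
    1173474125726126152, 2346948251452252304, 4693896502904504608,
    9370055752948945409, 73933383415978033736, 147866766831956067472]

/-- Pairing check of the 144 bases. -/
theorem logOK144 : logOK 144 bb144HX bb144HZ LZ144 LX144 = true := by decide +kernel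

/-- Pairing check of the 72 bases. -/
theorem logOK72 : logOK 72 bb72HX bb72HZ LZ72 LX72 = true := by decide +kernel

/-- The six functionals are `X`-type operators commuting with every `Z`-check of `BB.bb144`. -/
theorem Lam2_orth : (Lam2.all fun l => synZero 144 bb144HZ l) = true := by decide +kernel

end Summit.Ventures.QEC.Census.BB288Cover
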